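import Mathlib
import Summits.AtomisticToContinuum.HydrodynamicLimit.Theorems.ImplosionDichotomyDenseExcursionCavityExterior
import Summits.AtomisticToContinuum.HydrodynamicLimit.Theorems.ImplosionDichotomyDenseExcursionSonicRealBoundUnique

/-!
# The Wronskian of the mode equations and uniqueness on non-characteristic intervals (for theorem T3)
# (crux `DenseExcursion`, line `sonic-cavity-renewal`, brick for stub `stub_cavityResolventCk`)

Helper file (`--supports stmt-AtomisticToContinuum-12586`, line lead a2, stub-worker E for `stub_cavityResolventCk`,
theorem T3 `centre_regular_branch` of its decomposition — tools for its UNIQUENESS half `centre_regular_unique`,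
file `…CavityCentreUnique`):

* `eqOn_of_solutions` — uniqueness of the IVP for the resolvent equation `Λŵ − linW = f`, `Λŝ − linS = g` on any open
  interval where `W − 1 ± S ≠ 0` (characteristic variables `ŵ ± 3ŝ` + `eqOn_of_affine_solution_two`);
* `wronskian_hasDerivAt` — ABEL'S IDENTITY: for two solutions of the homogeneous equations, `w = ŵ₁ŝ₂ − ŵ₂ŝ₁` has
  `w′ = (T/det)·w` off the characteristic set, `det = (W−1)² − S²`,
  `T = (W−1)(2Λ − b₃ − b₆) + 3S·b₅ + (S/3)·b₄` (`b₃ = W′+2W−r`, `b₄ = 3S′+6S`, `b₅ = S′+2S`, `b₆ = W′/3+2W−r`;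
  from `mode_cramer`); `re_T_eq`: `Re T = (W−1)(2 Re Λ − b₃ − b₆) + 4S(S′+2S)`;
* `three_mul_neg_det_le_re_T` — THE CENTRE SIGN: under the tube envelope (`|W| ≤ 1/4`, `|W′| ≤ 1/2`, `eˣS ≥ 7/10`),
  `|(eˣS)′| ≤ 1/20` and `(5/2)(|Re Λ| + 1 + r)e^{2x} ≤ 7/20`: `3(S² − (W−1)²) ≤ Re T`, i.e. `Re(T/det) ≤ −3`
  (`det < 0`); at the centre `T/det → −4(1 + s̃′/s̃) ≈ −4`;
* `lin_const_mul`, `lin_zero`, and the registered helper `homogeneous_eq_zero_of_zero` — a differentiable solution of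
  the HOMOGENEOUS equations on `x ≤ −X` (`X ≥ 0`) vanishing at one point `x₀ < −X` vanishes on `x ≤ −X` (the system is
  regular on `x < 0`, where `W + S > 1`, `W ≤ 1/4`, `S > 0` give `W − 1 ± S ≠ 0`; the endpoint by continuity).

Sources: folklore (Abel's identity; Coddington–Levinson Ch. 3 §1).
-/

noncomputable section

open Set Filter
open scoped Topology ContDiff ComplexConjugate

namespace Summit.AtomisticToContinuum.HydrodynamicLimit.Theorems.SonicCavityRenewal

open Summit.AtomisticToContinuum.HydrodynamicLimit.Theorems.R2OneModeTwoConditions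

/-! ## Uniqueness for the resolvent equation on a non-characteristic open interval -/

/-- UNIQUENESS OF THE IVP FOR THE RESOLVENT EQUATION ON A NON-CHARACTERISTIC OPEN INTERVAL: two differentiable
solutions of `Λŵ − linW = f`, `Λŝ − linS = g` on `(α, β)`, where `W − 1 ± S ≠ 0`, agreeing at one point agree on
`(α, β)` (characteristic variables `ŵ ± 3ŝ` + `eqOn_of_affine_solution_two`). [folklore] -/
theorem eqOn_of_solutions {r : ℝ} {W S : ℝ → ℝ} (hW : ContDiff ℝ ∞ W) (hS : ContDiff ℝ ∞ S) {α β t₀ : ℝ}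
    (ht₀ : t₀ ∈ Ioo α β) (hnc : ∀ x ∈ Ioo α β, W x - 1 + S x ≠ 0 ∧ W x - 1 - S x ≠ 0) {Λ : ℂ}
    {f g ŵ ŝ ŵ' ŝ' : ℝ → ℂ} (hd : ∀ x ∈ Ioo α β, DifferentiableAt ℝ ŵ x ∧ DifferentiableAt ℝ ŝ x)
    (hd' : ∀ x ∈ Ioo α β, DifferentiableAt ℝ ŵ' x ∧ DifferentiableAt ℝ ŝ' x)
    (hsol : ∀ x ∈ Ioo α β, Λ * ŵ x - linW r W S ŵ ŝ x = f x ∧ Λ * ŝ x - linS r W S ŵ ŝ x = g x)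
    (hsol' : ∀ x ∈ Ioo α β, Λ * ŵ' x - linW r W S ŵ' ŝ' x = f x ∧ Λ * ŝ' x - linS r W S ŵ' ŝ' x = g x)
    (h0 : ŵ t₀ = ŵ' t₀) (h0' : ŝ t₀ = ŝ' t₀) : EqOn ŵ ŵ' (Ioo α β) ∧ EqOn ŝ ŝ' (Ioo α β) := by
  have hW' : ContDiff ℝ ∞ (deriv W) := (contDiff_infty_iff_deriv.1 hW).2
  have hS' : ContDiff ℝ ∞ (deriv S) := (contDiff_infty_iff_deriv.1 hS).2
  obtain ⟨Cp, hCp⟩ : ∃ C : ℝ → ℂ, C = fun x => ((W x - 1 + S x : ℝ) : ℂ) := ⟨_, rfl⟩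
  obtain ⟨Cm, hCm⟩ : ∃ C : ℝ → ℂ, C = fun x => ((W x - 1 - S x : ℝ) : ℂ) := ⟨_, rfl⟩
  obtain ⟨Bpp, hBpp⟩ : ∃ B : ℝ → ℂ,
      B = fun x => ((2 / 3 * deriv W x + 2 * W x - r + 2 * deriv S x + 4 * S x : ℝ) : ℂ) := ⟨_, rfl⟩
  obtain ⟨Bpm, hBpm⟩ : ∃ B : ℝ → ℂ, B = fun x => ((deriv W x / 3 + deriv S x + 2 * S x : ℝ) : ℂ) := ⟨_, rfl⟩
  obtain ⟨Bmp, hBmp⟩ : ∃ B : ℝ → ℂ, B = fun x => ((deriv W x / 3 - deriv S x - 2 * S x : ℝ) : ℂ) := ⟨_, rfl⟩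
  obtain ⟨Bmm, hBmm⟩ : ∃ B : ℝ → ℂ,
      B = fun x => ((2 / 3 * deriv W x + 2 * W x - r - 2 * deriv S x - 4 * S x : ℝ) : ℂ) := ⟨_, rfl⟩
  have cCp : Continuous Cp := by
    rw [hCp]; exact Complex.continuous_ofReal.comp ((hW.continuous.sub continuous_const).add hS.continuous)
  have cCm : Continuous Cm := by
    rw [hCm]; exact Complex.continuous_ofReal.comp ((hW.continuous.sub continuous_const).sub hS.continuous)
  have cBpp : Continuous Bpp := by rw [hBpp]; exact Complex.continuous_ofReal.comp (by fun_prop)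
  have cBpm : Continuous Bpm := by rw [hBpm]; exact Complex.continuous_ofReal.comp (by fun_prop)
  have cBmp : Continuous Bmp := by rw [hBmp]; exact Complex.continuous_ofReal.comp (by fun_prop)
  have cBmm : Continuous Bmm := by rw [hBmm]; exact Complex.continuous_ofReal.comp (by fun_prop)
  have Cp0 : ∀ x ∈ Ioo α β, Cp x ≠ 0 := fun x hx => by
    simp only [hCp, ne_eq, Complex.ofReal_eq_zero]; exact (hnc x hx).1
  have Cm0 : ∀ x ∈ Ioo α β, Cm x ≠ 0 := fun x hx => by
    simp only [hCm, ne_eq, Complex.ofReal_eq_zero]; exact (hnc x hx).2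
  set a₁₁ : ℝ → ℂ := fun t => (Λ - Bpp t) * (Cp t)⁻¹ with ha₁₁
  set a₁₂ : ℝ → ℂ := fun t => -Bpm t * (Cp t)⁻¹ with ha₁₂
  set b₁ : ℝ → ℂ := fun t => -(f t + 3 * g t) * (Cp t)⁻¹ with hb₁
  set a₂₁ : ℝ → ℂ := fun t => -Bmp t * (Cm t)⁻¹ with ha₂₁
  set a₂₂ : ℝ → ℂ := fun t => (Λ - Bmm t) * (Cm t)⁻¹ with ha₂₂
  set b₂ : ℝ → ℂ := fun t => -(f t - 3 * g t) * (Cm t)⁻¹ with hb₂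
  have cinvp : ContinuousOn (fun t => (Cp t)⁻¹) (Ioo α β) := cCp.continuousOn.inv₀ Cp0
  have cinvm : ContinuousOn (fun t => (Cm t)⁻¹) (Ioo α β) := cCm.continuousOn.inv₀ Cm0
  have ca₁₁ : ContinuousOn a₁₁ (Ioo α β) := (continuousOn_const.sub cBpp.continuousOn).mul cinvp
  have ca₁₂ : ContinuousOn a₁₂ (Ioo α β) := cBpm.continuousOn.neg.mul cinvp
  have ca₂₁ : ContinuousOn a₂₁ (Ioo α β) := cBmp.continuousOn.neg.mul cinvm
  have ca₂₂ : ContinuousOn a₂₂ (Ioo α β) := (continuousOn_const.sub cBmm.continuousOn).mul cinvm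
  -- any differentiable solution solves the characteristic system
  have hchar : ∀ {u v : ℝ → ℂ}, (∀ x ∈ Ioo α β, DifferentiableAt ℝ u x ∧ DifferentiableAt ℝ v x) →
      (∀ x ∈ Ioo α β, Λ * u x - linW r W S u v x = f x ∧ Λ * v x - linS r W S u v x = g x) →
      ∀ t ∈ Ioo α β,
        HasDerivAt (fun x => u x + 3 * v x) (a₁₁ t * (u t + 3 * v t) + a₁₂ t * (u t - 3 * v t) + b₁ t) t ∧
        HasDerivAt (fun x => u x - 3 * v x) (a₂₁ t * (u t + 3 * v t) + a₂₂ t * (u t - 3 * v t) + b₂ t) t := by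
    intro u v hduv hsoluv t ht
    obtain ⟨e1, e2⟩ := (lin_iff_char r W S Λ u v (f t) (g t) t).1 (hsoluv t ht)
    have e1' : Cp t * (deriv u t + 3 * deriv v t) =
        (Λ - Bpp t) * (u t + 3 * v t) - Bpm t * (u t - 3 * v t) - (f t + 3 * g t) := by
      simp only [hCp, hBpp, hBpm]; exact e1
    have e2' : Cm t * (deriv u t - 3 * deriv v t) =
        -Bmp t * (u t + 3 * v t) + (Λ - Bmm t) * (u t - 3 * v t) - (f t - 3 * g t) := by
      simp only [hCm, hBmp, hBmm]; exact e2
    have hc1 : Cp t ≠ 0 := Cp0 t ht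
    have hc2 : Cm t ≠ 0 := Cm0 t ht
    obtain ⟨hdu, hdv⟩ := hduv t ht
    constructor
    · have hD : HasDerivAt (fun x => u x + 3 * v x) (deriv u t + 3 * deriv v t) t :=
        hdu.hasDerivAt.add (hdv.hasDerivAt.const_mul 3)
      convert hD using 1
      rw [eq_inv_mul_of_mul_eq_left hc1 e1']
      simp only [ha₁₁, ha₁₂, hb₁]
      ring
    · have hD : HasDerivAt (fun x => u x - 3 * v x) (deriv u t - 3 * deriv v t) t :=
        hdu.hasDerivAt.sub (hdv.hasDerivAt.const_mul 3)
      convert hD using 1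
      rw [eq_inv_mul_of_mul_eq_left hc2 e2']
      simp only [ha₂₁, ha₂₂, hb₂]
      ring
  obtain ⟨ep, eq'⟩ := eqOn_of_affine_solution_two a₁₁ a₁₂ a₂₁ a₂₂ b₁ b₂ α β t₀ ht₀ ca₁₁ ca₁₂ ca₂₁ ca₂₂
    (fun x => ŵ x + 3 * ŝ x) (fun x => ŵ x - 3 * ŝ x) (fun x => ŵ' x + 3 * ŝ' x) (fun x => ŵ' x - 3 * ŝ' x)
    (hchar hd hsol) (hchar hd' hsol') (by simp only [h0, h0']) (by simp only [h0, h0'])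
  refine ⟨fun x hx => ?_, fun x hx => ?_⟩
  · have h1 := ep hx; have h2 := eq' hx
    simp only at h1 h2
    linear_combination (1 / 2 : ℂ) * h1 + (1 / 2 : ℂ) * h2
  · have h1 := ep hx; have h2 := eq' hx
    simp only at h1 h2
    linear_combination (1 / 6 : ℂ) * h1 - (1 / 6 : ℂ) * h2

/-! ## The Wronskian of two solutions of the homogeneous equations -/

/-- **ABEL'S IDENTITY FOR THE MODE EQUATIONS.** For two pairs solving the homogeneous equations `Λŵ = linW`,
`Λŝ = linS` at a point where `det = (W−1)² − S² ≠ 0`, the Wronskian `w = ŵ₁ŝ₂ − ŵ₂ŝ₁` has derivative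
`(T/det)·w`, `T = (W−1)(2Λ − b₃ − b₆) + 3S·b₅ + (S/3)·b₄` (the trace of `A⁻¹(Λ − B)` times `det`;
`mode_cramer`). [folklore] -/
theorem wronskian_hasDerivAt {r : ℝ} {W S : ℝ → ℝ} {Λ : ℂ} {ŵ₁ ŝ₁ ŵ₂ ŝ₂ : ℝ → ℂ} {x : ℝ}
    (hd₁ : DifferentiableAt ℝ ŵ₁ x) (hd₁' : DifferentiableAt ℝ ŝ₁ x) (hd₂ : DifferentiableAt ℝ ŵ₂ x)
    (hd₂' : DifferentiableAt ℝ ŝ₂ x) (h₁ : Λ * ŵ₁ x = linW r W S ŵ₁ ŝ₁ x) (h₁' : Λ * ŝ₁ x = linS r W S ŵ₁ ŝ₁ x)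
    (h₂ : Λ * ŵ₂ x = linW r W S ŵ₂ ŝ₂ x) (h₂' : Λ * ŝ₂ x = linS r W S ŵ₂ ŝ₂ x)
    (hdet : (W x - 1) ^ 2 - S x ^ 2 ≠ 0) :
    HasDerivAt (fun y => ŵ₁ y * ŝ₂ y - ŵ₂ y * ŝ₁ y)
      ((((W x - 1 : ℝ) : ℂ) * (2 * Λ - ((deriv W x + 2 * W x - r : ℝ) : ℂ) - ((deriv W x / 3 + 2 * W x - r : ℝ) : ℂ)) +
          ((3 * S x : ℝ) : ℂ) * ((deriv S x + 2 * S x : ℝ) : ℂ) +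
          ((S x / 3 : ℝ) : ℂ) * ((3 * deriv S x + 6 * S x : ℝ) : ℂ)) /
        (((W x - 1) ^ 2 - S x ^ 2 : ℝ) : ℂ) * (ŵ₁ x * ŝ₂ x - ŵ₂ x * ŝ₁ x)) x := by
  obtain ⟨e₁, e₂⟩ := mode_cramer h₁ h₁'
  obtain ⟨e₃, e₄⟩ := mode_cramer h₂ h₂'
  have hD : HasDerivAt (fun y => ŵ₁ y * ŝ₂ y - ŵ₂ y * ŝ₁ y)
      (deriv ŵ₁ x * ŝ₂ x + ŵ₁ x * deriv ŝ₂ x - (deriv ŵ₂ x * ŝ₁ x + ŵ₂ x * deriv ŝ₁ x)) x :=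
    (hd₁.hasDerivAt.mul hd₂'.hasDerivAt).sub (hd₂.hasDerivAt.mul hd₁'.hasDerivAt)
  convert hD using 1
  have hdetC : (((W x - 1) ^ 2 - S x ^ 2 : ℝ) : ℂ) ≠ 0 := Complex.ofReal_ne_zero.2 hdet
  rw [div_mul_eq_mul_div, div_eq_iff hdetC]
  linear_combination (-ŝ₂ x) * e₁ - ŵ₁ x * e₄ + ŝ₁ x * e₃ + ŵ₂ x * e₂

/-- THE REAL PART OF `T` (real coefficients): `Re T = (W−1)(2 Re Λ − b₃ − b₆) + 4S(S′ + 2S)`. [folklore] -/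
theorem re_T_eq (Λ : ℂ) (w w' s s' r : ℝ) :
    ((((w - 1 : ℝ) : ℂ) * (2 * Λ - ((w' + 2 * w - r : ℝ) : ℂ) - ((w' / 3 + 2 * w - r : ℝ) : ℂ)) +
          ((3 * s : ℝ) : ℂ) * ((s' + 2 * s : ℝ) : ℂ) + ((s / 3 : ℝ) : ℂ) * ((3 * s' + 6 * s : ℝ) : ℂ))).re =
      (w - 1) * (2 * Λ.re - (w' + 2 * w - r) - (w' / 3 + 2 * w - r)) + 4 * s * (s' + 2 * s) := by
  simp only [Complex.add_re, Complex.mul_re, Complex.sub_re, Complex.ofReal_re, Complex.ofReal_im,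
    Complex.sub_im, Complex.mul_im, Complex.re_ofNat, Complex.im_ofNat]
  ring

/-- THE CENTRE SIGN OF `Re(T/det)`: under the tube envelope `|W| ≤ 1/4`, `|W′| ≤ 1/2`, `7/10 ≤ eˣS ≤ 1`, the
derivative bound `|(eˣS)′| ≤ 1/20` and the smallness `(5/2)(|Re Λ| + 1 + r)·e^{2x} ≤ 7/20` (`1 ≤ r`), one has
`3(S² − (W−1)²) ≤ Re T`, i.e. `Re(T/det) ≤ −3` since `det < 0`. [folklore] -/
theorem three_mul_neg_det_le_re_T {Λ : ℂ} {w w' s s' r x : ℝ} (hr : 1 ≤ r) (hw : |w| ≤ 1 / 4)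
    (hw' : |w'| ≤ 1 / 2) (hs₁ : 7 / 10 ≤ Real.exp x * s) (hs' : |Real.exp x * s + Real.exp x * s'| ≤ 1 / 20)
    (hsmall : 5 / 2 * (|Λ.re| + 1 + r) * Real.exp (2 * x) ≤ 7 / 20) :
    3 * (s ^ 2 - (w - 1) ^ 2) ≤ (w - 1) * (2 * Λ.re - (w' + 2 * w - r) - (w' / 3 + 2 * w - r)) + 4 * s * (s' + 2 * s) := by
  set E : ℝ := Real.exp x with hE
  have hE0 : 0 < E := Real.exp_pos x
  have hE2 : Real.exp (2 * x) = E ^ 2 := by rw [hE, ← Real.exp_nat_mul]; norm_num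
  rw [hE2] at hsmall
  -- the main positive term: `s(4(s′ + s) + s) ≥ 7/(20 E²)`, written as `E² · s(4(s′+s)+s) ≥ 7/20`
  have hspos : 0 < s := by nlinarith
  have h1 : 7 / 20 ≤ E ^ 2 * (s * (4 * (s' + s) + s)) := by
    have ha : 7 / 10 ≤ E * s := hs₁
    have hb : 1 / 2 ≤ E * (4 * (s' + s) + s) := by
      have := (abs_le.1 hs').1
      nlinarith
    calc (7 / 20 : ℝ) = 7 / 10 * (1 / 2) := by norm_num
      _ ≤ (E * s) * (E * (4 * (s' + s) + s)) := mul_le_mul ha hb (by norm_num) (by nlinarith)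
      _ = E ^ 2 * (s * (4 * (s' + s) + s)) := by ring
  -- the bounded term
  have h2 : |(w - 1) * (2 * Λ.re - (w' + 2 * w - r) - (w' / 3 + 2 * w - r))| ≤ 5 / 2 * (|Λ.re| + 1 + r) := by
    rw [abs_mul]
    have hw1 : |w - 1| ≤ 5 / 4 := by
      have := abs_le.1 hw
      rw [abs_le]; constructor <;> linarith
    have hQ : |2 * Λ.re - (w' + 2 * w - r) - (w' / 3 + 2 * w - r)| ≤ 2 * |Λ.re| + 5 / 3 + 2 * r := by
      have h4w : |w'| ≤ 1 / 2 := hw'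
      rw [abs_le] at hw h4w ⊢
      have := abs_nonneg Λ.re
      have hre := abs_le.1 (le_refl |Λ.re|)
      constructor <;> nlinarith [le_abs_self Λ.re, neg_abs_le Λ.re]
    calc |w - 1| * |2 * Λ.re - (w' + 2 * w - r) - (w' / 3 + 2 * w - r)|
        ≤ 5 / 4 * (2 * |Λ.re| + 5 / 3 + 2 * r) :=
          mul_le_mul hw1 hQ (abs_nonneg _) (by norm_num)
      _ ≤ 5 / 2 * (|Λ.re| + 1 + r) := by nlinarith [abs_nonneg Λ.re]
  have h3 : -(E ^ 2 * ((w - 1) * (2 * Λ.re - (w' + 2 * w - r) - (w' / 3 + 2 * w - r)))) ≤ 7 / 20 := by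
    have := neg_abs_le ((w - 1) * (2 * Λ.re - (w' + 2 * w - r) - (w' / 3 + 2 * w - r)))
    nlinarith [sq_nonneg E]
  -- assemble: multiply the goal by `E² > 0`
  have hE20 : 0 < E ^ 2 := by positivity
  have key : E ^ 2 * (3 * (s ^ 2 - (w - 1) ^ 2)) ≤
      E ^ 2 * ((w - 1) * (2 * Λ.re - (w' + 2 * w - r) - (w' / 3 + 2 * w - r)) + 4 * s * (s' + 2 * s)) := by
    nlinarith [sq_nonneg (w - 1), h1, h3]
  exact le_of_mul_le_mul_left key hE20

/-! ## Registered helper: proportionality of centre-regular homogeneous solutions -/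

/-- `linW`, `linS` are homogeneous under complex scalars (differentiable pairs). [folklore] -/
theorem lin_const_mul {r : ℝ} {W S : ℝ → ℝ} {ŵ ŝ : ℝ → ℂ} (a : ℂ) {x : ℝ} (hw : DifferentiableAt ℝ ŵ x)
    (hs : DifferentiableAt ℝ ŝ x) :
    linW r W S (fun y => a * ŵ y) (fun y => a * ŝ y) x = a * linW r W S ŵ ŝ x ∧
      linS r W S (fun y => a * ŵ y) (fun y => a * ŝ y) x = a * linS r W S ŵ ŝ x := by
  unfold linW linS
  rw [deriv_const_mul a hw, deriv_const_mul a hs]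
  constructor <;> ring

/-- The zero pair is annihilated by `linW`, `linS`. [folklore] -/
theorem lin_zero (r : ℝ) (W S : ℝ → ℝ) (x : ℝ) :
    linW r W S (fun _ => 0) (fun _ => 0) x = 0 ∧ linS r W S (fun _ => 0) (fun _ => 0) x = 0 := by
  simp [linW, linS]

/-- **Registered helper `homogeneous_eq_zero_of_zero`: A SOLUTION OF THE HOMOGENEOUS EQUATIONS ON `x ≤ −X` (`X ≥ 0`)
VANISHING AT ONE POINT `x₀ < −X` VANISHES ON `x ≤ −X`** (for profiles with `W − 1 ± S ≠ 0` on `x < 0`): the system is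
regular on `x < 0`, so `eqOn_of_solutions` applies on every `(−Y, −X)`, and the endpoint `−X` is reached by continuity.
[folklore] -/
theorem homogeneous_eq_zero_of_zero : ∀ {r : ℝ} {W S : ℝ → ℝ}, ContDiff ℝ ∞ W → ContDiff ℝ ∞ S → (∀ x, x < 0 → W x - 1 + S x ≠ 0 ∧ W x - 1 - S x ≠ 0) → ∀ {Λ : ℂ} {X x₀ : ℝ}, 0 ≤ X → x₀ < -X → ∀ {ŵ ŝ : ℝ → ℂ}, Differentiable ℝ ŵ → Differentiable ℝ ŝ → (∀ x ∈ Set.Iic (-X), Λ * ŵ x = linW r W S ŵ ŝ x ∧ Λ * ŝ x = linS r W S ŵ ŝ x) → ŵ x₀ = 0 → ŝ x₀ = 0 → ∀ x ∈ Set.Iic (-X), ŵ x = 0 ∧ ŝ x = 0 := by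
  intro r W S hW hS hnc Λ X x₀ hX hx₀ ŵ ŝ hŵ hŝ hsol h0 h0'
  have key : ∀ Y : ℝ, -Y < x₀ → EqOn ŵ (fun _ => 0) (Ioo (-Y) (-X)) ∧ EqOn ŝ (fun _ => 0) (Ioo (-Y) (-X)) := by
    intro Y hY
    have hsub : ∀ x ∈ Ioo (-Y) (-X), x < 0 := fun x hx => lt_of_lt_of_le hx.2 (by linarith)
    refine eqOn_of_solutions (r := r) hW hS (t₀ := x₀) ⟨hY, hx₀⟩ (fun x hx => hnc x (hsub x hx)) (Λ := Λ)
      (f := fun _ => 0) (g := fun _ => 0) (fun x _ => ⟨hŵ x, hŝ x⟩)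
      (fun x _ => ⟨differentiableAt_const _, differentiableAt_const _⟩) (fun x hx => ?_) (fun x _ => ?_) h0 h0'
    · obtain ⟨h1, h2⟩ := hsol x (le_of_lt hx.2)
      exact ⟨by rw [h1, sub_self], by rw [h2, sub_self]⟩
    · obtain ⟨h1, h2⟩ := lin_zero r W S x
      exact ⟨by rw [h1]; ring, by rw [h2]; ring⟩
  intro x hx
  set Y : ℝ := max (-x) (-x₀) + 1 with hY
  obtain ⟨e1, e2⟩ := key Y (by rw [hY]; linarith [le_max_right (-x) (-x₀)])
  have hcl : closure (Ioo (-Y) (-X)) = Icc (-Y) (-X) := closure_Ioo (by rw [hY]; linarith [le_max_right (-x) (-x₀)])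
  have hxI : x ∈ Icc (-Y) (-X) := ⟨by rw [hY]; linarith [le_max_left (-x) (-x₀)], hx⟩
  have e1c := e1.closure hŵ.continuous continuous_const
  have e2c := e2.closure hŝ.continuous continuous_const
  rw [hcl] at e1c e2c
  exact ⟨e1c hxI, e2c hxI⟩

end Summit.AtomisticToContinuum.HydrodynamicLimit.Theorems.SonicCavityRenewal

end
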